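import Mathlib
import HarnessLib
import Literature.NumberTheory.LFunctions.CriticalLineTwoThirds

/-!
# RH-FREE — Hua–Yang 2026 (arXiv:2608.16034), Theorem 2.1: in the prime-modulus Dirichlet FAMILY, at every height from `(log log q)^{1+η}/log q` to `(log q)^{A₀}`, at least `0.6725` of the zeros are simple and on the critical line and `0.83625` are distinct, unconditionally — typed AS PRINTED as claims of an unrefereed preprint

LABEL (cell `landau-siegel`, §C literature harvest, topic r5; HARVEST row r5-R20; bears_on F-S3 §C /
§B-det / §B-ell): the FAMILY, CONDUCTOR-UNIFORM, LOW-HEIGHT version of the mollifier-free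
explicit-formula/inertia detector of Alpöge–Furman (`CriticalLineTwoThirds.lean`), i.e. the regime
`T ≍ (log q)^ξ`, `ξ > −1`, of a character family — with the printed limitation that the window of
`O(1)` mean spacings (`T log q ≍ 1`) is NOT reached (§12). «The programme SEARCHES and TYPES; no
claim about Landau–Siegel zeros, Theorems 1–2 of arXiv:2211.02515 or a repaired Margin232 until a
kernel theorem says so.»

Topic `Literature/NumberTheory/LFunctions` (namespace `Literature.NumberTheory.LFunctions`; the
family counts and constants in the sub-namespace `HuaYang2026`). STATEMENT LAYER (D-0014): ONE
named fact (Theorem 2.1 with (2.5)), as `[claim: HuaYang2026, status: under-review]` (unrefereed,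
D-0012), over the window counts `AlpogeFurman2026.charWindowZeroCount` /
`charWindowSimpleCriticalZeroCount` / `charWindowDistinctZeroCount` of `CriticalLineTwoThirds.lean`
(one new count: distinct zeros ON the line), plus the two printed constants and their relation to
`montgomeryTaylorInvConstant` (proved, `rfl`-level algebra).

## What the source prints (held text `paper:arxiv-2608.16034`, v2 of 24 Aug 2026, chunks
## p0001–p0005, p0031–p0033 read 2026-08-26)

Z. Hua, X. Yang, *Simple and distinct zeros in a prime-modulus Dirichlet family from
near-microscopic to polylogarithmic heights*, arXiv:2608.16034 [HuaYang2026]. §2.1 (p. 3–4):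
`q` an odd prime, `Q = log q`, `(log Q)^{1+η}/Q ≤ T ≤ Q^{A₀}` (2.1), `I = (T, 2T]`; for `χ ≠ χ₀`
(mod `q`): `N_χ(I) = Σ_{L(ρ,χ)=0, T<Im ρ≤2T} m_ρ` (2.2) (non-trivial zeros, with multiplicity),
`N^s_{0,χ}(I)` = zeros in `I` on `Re s = ½` of multiplicity one, `N*_{0,χ}(I) = #{γ ∈ I :
L(½+iγ,χ) = 0}`, `N_{d,χ}(I) = #{ρ : L(ρ,χ) = 0, ρ nontrivial, T < Im ρ ≤ 2T}` (2.2a); family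
counts `N_q = Σ_{χ≠χ₀} N_χ(I)`, `N^s_{0,q}`, `N*_{0,q}`, `N_{d,q}` likewise (2.3).

> **Theorem 2.1.** For every fixed `η > 0` and `A₀ > 0`, uniformly for all `T` satisfying (2.1),
> `N^s_{0,q}/N_q ≥ C_MT − o_{η,A₀}(1)`, `C_MT := 3/2 − (1/√2) cot(1/√2)` (2.4);
> `N*_{0,q}/N_q ≥ C_MT − o_{η,A₀}(1)`, `N_{d,q}/N_q ≥ C_d − o_{η,A₀}(1)`,
> `C_d := (1 + C_MT)/2 = 5/4 − (1/(2√2)) cot(1/√2)` (2.4a). Moreover, uniformly in the same range,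
> `N_q = (qT log q/2π){1 + o_{η,A₀}(1)}` (2.5). Here every `o_{η,A₀}(1)` tends to zero as
> `q → ∞`, uniformly in `T` throughout (2.1).

`C_MT = 0.672500703679…`, `C_d = 0.836250351839…` (abstract). Remark 2.2: "The theorem is not
claimed at the exact fixed-normalized-window scale `TQ ≍ 1`." §12 (p0033): "Reaching that scale
would require a genuinely finite-normalized-window certificate and a sharper family counting input;
choosing any fixed Gevrey order `s > 1` or increasing the number of integrations by parts does not
repair it." Inputs (§1, §3): Weil's explicit formula with exact character orthogonality for prime
polynomials of length `q^λ < q` (`0 < λ < 1`, Prop. 11.1 gives the `λ`-dependent constant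
`2 − (1 + (λ/√2)tan(λ/√2))/(√2 tan(λ/√2))`, `λ ↑ 1` at the end), Selberg's family-averaged
argument estimate, the Hiary–Zhao zero-density deletion of `O(q/Q²)` exceptional characters, a
finite Gevrey Gabor compression of Weil's Hermitian form and the rank–trace inequality of
Alpöge–Furman (Lemma 3.2 there; PROVED in this tree: `AlpogeFurman2026_rank_trace_holds`). "No form
of the generalized Riemann hypothesis is assumed." (abstract).

## Lean rendering (audit notes)

* Windows `(T, 2T]` and multiplicities exactly as in `CriticalLineTwoThirds.lean`
  (`AlpogeFurman2026.charWindow…`, zeros `ExplicitPsiChar.charNontrivialZeros χ`, multiplicity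
  `DirichletDisc.zeroOrder χ ρ`); `N*_{0,χ}` (distinct zeros ON the line) is the one new count
  (`HuaYang2026.charWindowDistinctCriticalZeroCount`). Family sums over `χ ≠ 1` mod `q`
  (`Finset.univ.filter`), `q` an odd prime (`[NeZero q]` carried as an instance argument, as in
  `AlpogeFurman2026_dirichlet_simple_critical_dyadic`).
* "uniformly for all `T` satisfying (2.1)", "`o(1) → 0` as `q → ∞` uniformly in `T`": for every
  `ε > 0` there is `q₀` such that the four inequalities hold for all odd primes `q ≥ q₀` and all `T`
  in the range (2.1); (2.5) is rendered two-sidedly `|N_q − qT log q/(2π)| ≤ ε · qT log q/(2π)`.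
* `(log Q)^{1+η}` is the real power `Real.rpow` of `log log q` (positive for `q ≥ 3`).

## References

* [HuaYang2026] as above: abstract, §1, §2.1 Theorem 2.1, Remark 2.2, Prop. 11.1, §12, §13.
* [AlpogeFurman2026] L. Alpöge, R. Furman, arXiv:2608.13637 (tree: `CriticalLineTwoThirds.lean`,
  `CriticalLineTwoThirdsProofs.lean`).
-/

noncomputable section

open Complex Filter Set

namespace Literature.NumberTheory.LFunctions

namespace HuaYang2026

variable {q : ℕ} [NeZero q]

/-- `N*_{0,χ}(T₁,T₂) = #{γ ∈ (T₁,T₂] : L(½+iγ,χ) = 0}`: the DISTINCT zeros of `L(s,χ)` ON the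
critical line with `T₁ < Im ρ ≤ T₂` (a multiple zero counted once).
[cite: HuaYang2026, §2.1 eq. (2.2a)] -/
def charWindowDistinctCriticalZeroCount (χ : DirichletCharacter ℂ q) (T₁ T₂ : ℝ) : ℕ :=
  Set.ncard {ρ : ℂ | ρ ∈ ExplicitPsiChar.charNontrivialZeros χ ∧ T₁ < ρ.im ∧ ρ.im ≤ T₂ ∧
    ρ.re = 1 / 2}

/-- `N_q(T₁,T₂) = Σ_{χ ≠ χ₀} N_χ((T₁,T₂])`, zeros with multiplicity.
[cite: HuaYang2026, §2.1 eq. (2.3)] -/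
def familyZeroCount (q : ℕ) [NeZero q] (T₁ T₂ : ℝ) : ℕ :=
  ∑ χ : DirichletCharacter ℂ q with χ ≠ 1, AlpogeFurman2026.charWindowZeroCount χ T₁ T₂

/-- `N^s_{0,q}(T₁,T₂) = Σ_{χ ≠ χ₀} N^s_{0,χ}`: simple zeros on the critical line.
[cite: HuaYang2026, §2.1 eq. (2.3)] -/
def familySimpleCriticalZeroCount (q : ℕ) [NeZero q] (T₁ T₂ : ℝ) : ℕ :=
  ∑ χ : DirichletCharacter ℂ q with χ ≠ 1,
    AlpogeFurman2026.charWindowSimpleCriticalZeroCount χ T₁ T₂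

/-- `N*_{0,q}(T₁,T₂) = Σ_{χ ≠ χ₀} N*_{0,χ}`: distinct zeros on the critical line.
[cite: HuaYang2026, §2.1 eq. (2.3)] -/
def familyDistinctCriticalZeroCount (q : ℕ) [NeZero q] (T₁ T₂ : ℝ) : ℕ :=
  ∑ χ : DirichletCharacter ℂ q with χ ≠ 1, charWindowDistinctCriticalZeroCount χ T₁ T₂

/-- `N_{d,q}(T₁,T₂) = Σ_{χ ≠ χ₀} N_{d,χ}`: distinct non-trivial zeros.
[cite: HuaYang2026, §2.1 eq. (2.3)] -/
def familyDistinctZeroCount (q : ℕ) [NeZero q] (T₁ T₂ : ℝ) : ℕ :=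
  ∑ χ : DirichletCharacter ℂ q with χ ≠ 1, AlpogeFurman2026.charWindowDistinctZeroCount χ T₁ T₂

/-- `C_MT := 3/2 − (1/√2) cot(1/√2) = 0.672500703679…` (2.4).
[cite: HuaYang2026, Theorem 2.1 eq. (2.4)] -/
def cMT : ℝ :=
  3 / 2 - (1 / Real.sqrt 2) * Real.cot (1 / Real.sqrt 2)

/-- `C_d := (1 + C_MT)/2 = 5/4 − (1/(2√2)) cot(1/√2) = 0.836250351839…` (2.4a).
[cite: HuaYang2026, Theorem 2.1 eq. (2.4a)] -/
def cD : ℝ :=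
  (1 + cMT) / 2

/-- `C_MT = 2 − c_MT⁻¹` with `c_MT⁻¹ = ½ + (1/√2) cot(1/√2)` the Montgomery–Taylor constant of
`CriticalLineTwoThirds.lean` — the same proportion as Alpöge–Furman's Theorem A with the
Montgomery–Taylor window. [cite: HuaYang2026, Theorem 2.1 eq. (2.4)] -/
theorem cMT_eq : cMT = 2 - montgomeryTaylorInvConstant := by
  unfold cMT montgomeryTaylorInvConstant
  ring

/-- `C_d = ½(3 − c_MT⁻¹)`, Alpöge–Furman's distinct-zero constant with the Montgomery–Taylor
window. [cite: HuaYang2026, Theorem 2.1 eq. (2.4a)] -/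
theorem cD_eq : cD = (3 - montgomeryTaylorInvConstant) / 2 := by
  unfold cD
  rw [cMT_eq]
  ring

end HuaYang2026

/-- **Hua–Yang 2026, Theorem 2.1 with (2.5)** (arXiv preprint, UNDER REVIEW; NAMED CLAIM, not
proved here). For every `η > 0`, `A₀ > 0` and `ε > 0` there is `q₀` such that for every odd
prime `q ≥ q₀` and every height `T` with `(log log q)^{1+η}/log q ≤ T ≤ (log q)^{A₀}`, with all
counts over the window `(T, 2T]` and summed over the nonprincipal characters mod `q`:
`N^s_{0,q} ≥ (C_MT − ε) N_q`, `N*_{0,q} ≥ (C_MT − ε) N_q`, `N_{d,q} ≥ (C_d − ε) N_q`, and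
`|N_q − qT log q/(2π)| ≤ ε · qT log q/(2π)`. Printed: "For every fixed `η > 0` and `A₀ > 0`,
uniformly for all `T` satisfying (2.1), `N^s_{0,q}/N_q ≥ C_MT − o_{η,A₀}(1)` … `N*_{0,q}/N_q ≥
C_MT − o(1)`, `N_{d,q}/N_q ≥ C_d − o(1)` … Moreover, uniformly in the same range,
`N_q = (qT log q/2π){1 + o(1)}`." Not claimed at `T log q ≍ 1` (Remark 2.2, §12).
[claim: HuaYang2026, status: under-review] -/
def huaYang2026_theorem21 : Prop :=
  ∀ η : ℝ, 0 < η → ∀ A₀ : ℝ, 0 < A₀ → ∀ ε : ℝ, 0 < ε →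
    ∃ q₀ : ℕ, ∀ (q : ℕ) [NeZero q], q.Prime → Odd q → q₀ ≤ q →
      ∀ T : ℝ, (Real.log (Real.log q)) ^ (1 + η) / Real.log q ≤ T → T ≤ (Real.log q) ^ A₀ →
        (HuaYang2026.cMT - ε) * (HuaYang2026.familyZeroCount q T (2 * T) : ℝ) ≤
            HuaYang2026.familySimpleCriticalZeroCount q T (2 * T) ∧
        (HuaYang2026.cMT - ε) * (HuaYang2026.familyZeroCount q T (2 * T) : ℝ) ≤
            HuaYang2026.familyDistinctCriticalZeroCount q T (2 * T) ∧
        (HuaYang2026.cD - ε) * (HuaYang2026.familyZeroCount q T (2 * T) : ℝ) ≤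
            HuaYang2026.familyDistinctZeroCount q T (2 * T) ∧
        dist (HuaYang2026.familyZeroCount q T (2 * T) : ℝ) (q * T * Real.log q / (2 * Real.pi)) ≤
            ε * (q * T * Real.log q / (2 * Real.pi))

end Literature.NumberTheory.LFunctions

end
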